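import Literature.NumberTheory.EllipticCurves.JZeroTwoPowerTorsionStableSubgroups
import Literature.NumberTheory.EllipticCurves.CasselsTateLocalTermLinePerp
import Literature.NumberTheory.EllipticCurves.LocalKummerMap
import Literature.NumberTheory.EllipticCurves.LocalTorsionOfTrivialGaloisAction
import Literature.NumberTheory.EllipticCurves.CasselsTateSelmerLocalValue
import HarnessLib

/-!
# The local Kummer parametrisation `κ : E[2^M] ⥲ 𝓛_v` at a finite place `v ∤ 2` with `E[2^M] ⊆ E(K_v)`,
# for a curve with a `K`-rational operator `f`, `f² + f + 1 = 0` (the `ℤ[ω]/2^M`-LINE form of `E(K_v)/2^M`)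

Topic `NumberTheory/EllipticCurves`; namespace `Literature.NumberTheory.EllipticCurves.JZero`. THEOREMS ONLY: **no
definition and no named fact** (D-0026). This is the hypothesis-package `(κ, hκ, hκs)` + the `𝒪`-linearity of `κ` of
`CasselsTateLocalTermLine.inv_weilLocalCup_ne_zero_or_of_line` / `ctLocalTerm_ne_zero_or_of_line` (#40), at
`E := v.adicCompletion K`, `n = 2^M` (apply with `n := m * m`, `M := 2κ`), item (κ2) of SPEC-K-TY § (T-L2′ LOCAL).

McCallum 1991 Lemma 5.3 is PRINTED for `p` odd, non-CM: «`E(K_λ)/p^M ≅ E[p^M]`, the `±`-parts cyclic of order `p^M`».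
For `p = 2` and a curve with complex multiplication by `𝒪 = ℤ[ω]` defined over `K` (`2` inert in `𝒪`) at a place
`v ∤ 2` with `E[2^M] ⊆ E(K_v)`, the right statement is: `E(K_v)/2^M ≅ E[2^M]` as an `𝒪/2^M`-module, free of rank
one (Rubin 1999 Cor. 5.5: `E[𝔞] ≅ 𝒪/𝔞`).  SUBTLETY (SPEC v18.20): the naive map `E[2^M] ⊆ E(K_v) ↠ E(K_v)/2^M` is NOT
onto in general — the `2`-primary torsion of `E(K_v)` is `E[2^j]` for the EXACT depth `j ≥ M` of the place, and one
must divide by `2^{j-M}` first.  We prove: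

* `smul_eq_self_of_forall_smul_geomTorsion_eq` — `E[2^N] ⊆ E(E)` (on `geomTorsion`, the RESIDUE's level clause) ⇒
  every `2^N`-torsion point of `E(K̄_E)` is `Γ_E`-fixed.
* `two_pow_zsmul_eq_zero_of_fixed_of_not_forall` — EXACTNESS: if NOT all of `E[2^{j+1}]` is `E`-rational, then every
  `E`-rational `2`-power-torsion point of `E(K̄_E)` is killed by `2^j` (the `Γ_E`-fixed part of `E[2^{N'}]` is
  `f`-stable, hence a sub-line `E[2^{N'}][2^i]` by UNISERIALITY, #42 `exists_mem_iff_two_pow_zsmul_eq_zero_of_fn_stable`).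
* `exists_not_forall_smul_geomTorsion_eq_adicCompletion` — at `K_v` some `E[2^N]` is not rational
  (`E(K_v)` has a torsion-free subgroup of finite index, Silverman VII.6.3: tree
  `exists_finiteIndex_torsionFree_adicCompletion`; `#E(K_v)[2^N] = 4^N` when rational, tree
  `natCard_ker_nsmul_adicCompletion_eq_sq_of_forall_smul_eq`).
* ★ `exists_kummerLocal_line_parametrisation` — for `n = 2^M`, `v ∤ 2`, `E[n] ⊆ E(K_v)`: **`∃ κ : E[n] →+ H¹(Γ_{K_v}, E[n])`,
  INTO `𝓛_v` (`hκ`), ONTO `𝓛_v` (`hκs`), INJECTIVE, and `𝒪`-LINEAR: `κ (fn Z) = H¹(F|Γ_{K_v}) (κ Z)`** for the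
  intertwining map `F` of `E[n]` over `f`.  Construction: `κ Z := κ_v(Q)` (tree `localKummerClass`) for ANY
  `Q ∈ E(K̄_v)` with `2^j Q = Z`, `j` the exact depth (`E[2^j]` rational, `E[2^{j+1}]` not); injective by
  exactness; onto by the COUNT `#𝓛_v = #E(K_v)[n] · #(𝓞_v/n) = n² = #E[n]` (tree `natCard_kummerLocalConditionAt_adicCompletion`,
  #41 `natCard_adicCompletionIntegers_quotient_span_natCast_eq_one`); linear by Kummer naturality (`f_v Q` is a root
  of `fn Z`; the cocycle identity `θ⁻¹ ∘ f_v = F ∘ θ⁻¹`, re-proved here because the tree's version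
  `…CoupledDescentCebotarevKummerImage.resH1Hom_id_kummerMapTorsion` is `Summits/`-side).
* `exists_kummerLocal_line_parametrisation_of_depth` — the same over any `K`-field `E` at a GIVEN exact depth `j`
  (INTO, INJECTIVE, `𝒪`-LINEAR; no count), and `mul_zsmul_ne_zero_of_map_mulK_eq_res` — the ORDER BOOKKEEPING for
  `hyb` of #40 (McCallum Prop. 4.4 coupling): `[m]_* β' = res b'`, `ι_* b' = t`, `res (c • t) ≠ 0 ⇒ (c * m) • β' ≠ 0`
  (`ι_* [m]_* = m`, tree `map_inclKD_map_mulK_restrictField`); with `mem_torsionLocalKer_iff_res_eq_zero` this turns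
  the display's `2^b • t ∉ ker loc_λ` into `2^{κ+b} • β'_λ ≠ 0`.  Still the caller's: `hx` (`a ↦ a + κ - N'` through
  `comap_res_kummerLocalConditionAt` and the FLIP) and the D′-swap (`ctLocalTerm_congr_right`, the `𝒪`-linearity,
  `galoisCohomology.res_map_one`, `map_inclKD_injective_of_forall_fixed_eq_zero`).

References: [McCallumLMS1991] W. G. McCallum, *Kolyvagin's work on Shafarevich–Tate groups*, LMS LN 153 (1991), §4
(p. 300: «`E(K_λ)_{p^M} = E_{p^M}`»), §5 Lemma 5.3; [Rubin1999] K. Rubin, *Elliptic curves with complex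
multiplication and the conjecture of Birch and Swinnerton-Dyer*, LNM 1716 (1999), Cor. 5.5; [SilvermanAEC2009] J. H. Silverman,
*AEC*, 2nd ed., VIII.§2 (the Kummer sequence), Prop. VII.6.3, Cor. III.6.4(b); [MilneADT2006] J. S. Milne, *ADT*, 2nd ed.,
I Lemma 3.3, §6 (6.14); [SerreGaloisCohomology1997] J.-P. Serre, *Galois Cohomology* (1997), I.§2.4 (functoriality of `H¹`).
-/

noncomputable section

open scoped Classical

universe u

namespace Literature.NumberTheory.EllipticCurves.JZero

open _root_.WeierstrassCurve Field Function
open Literature.NumberTheory.GaloisRepresentations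
open scoped ContRepresentation

/-! ## Rational `2`-power torsion: from the level clause on `E[2^N]` to the points of `E(K̄_E)` -/

section Generic

variable {K : Type u} [Field K] [CharZero K] (W : WeierstrassCurve K) [W.IsElliptic]
variable (E : Type u) [Field E] [Algebra K E]

/-- **`E[2^N] ⊆ E(E)` on points of `E(K̄_E)`**: if `Γ_E` fixes `E[2^N](K̄)` (the level clause of a Kolyvagin prime,
McCallum §4 «`E(K_λ)_{p^M} = E_{p^M}`»), every `T ∈ E(K̄_E)` with `2^N T = 0` is `Γ_E`-fixed (torsion comparison
`torsionPointsEquiv`). [cite: McCallumLMS1991, §4 (p. 300)] [cite: SilvermanAEC2009, Cor. III.6.4(b)] -/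
theorem smul_eq_self_of_forall_smul_geomTorsion_eq {N : ℕ}
    (hrat : ∀ (g : absoluteGaloisGroup E) (Q : geomTorsion W ((2 ^ N : ℕ) : ℤ)), absGaloisRestrict K E g • Q = Q)
    {T : localPoints W E} (hT : ((2 ^ N : ℕ) : ℤ) • T = 0) (σ : absoluteGaloisGroup E) : σ • T = T := by
  have hn : ((2 ^ N : ℕ) : ℤ) ≠ 0 := by exact_mod_cast pow_ne_zero N two_ne_zero
  have hT' : T ∈ AddSubgroup.torsionBy (localPoints W E) ((2 ^ N : ℕ) : ℤ) :=
    (Submodule.mem_torsionBy_iff _ _).mpr hT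
  have h := W.torsionPointsEquiv_symm_smul ((2 ^ N : ℕ) : ℤ) (E := E) hn σ ⟨T, hT'⟩
  rw [resGal_eq_absGaloisRestrict, hrat] at h
  exact congrArg (fun R : AddSubgroup.torsionBy (localPoints W E) ((2 ^ N : ℕ) : ℤ) ↦ (R : localPoints W E))
    ((W.torsionPointsEquiv ((2 ^ N : ℕ) : ℤ) (E := E) hn).symm.injective h)

/-- Conversely (private plumbing): a `Γ_E`-fixed `2^N`-torsion point of `E(K̄_E)` is `Γ_E`-fixed in `E[2^N](K̄)`. [folklore] -/
private theorem smul_torsionPointsEquiv_symm_eq_of_forall_smul_eq {N : ℕ} (hn : ((2 ^ N : ℕ) : ℤ) ≠ 0)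
    {T : localPoints W E} (hT : T ∈ AddSubgroup.torsionBy (localPoints W E) ((2 ^ N : ℕ) : ℤ))
    (hfix : ∀ σ : absoluteGaloisGroup E, σ • T = T) (g : absoluteGaloisGroup E) :
    absGaloisRestrict K E g • (W.torsionPointsEquiv ((2 ^ N : ℕ) : ℤ) (E := E) hn).symm ⟨T, hT⟩ =
      (W.torsionPointsEquiv ((2 ^ N : ℕ) : ℤ) (E := E) hn).symm ⟨T, hT⟩ := by
  rw [← resGal_eq_absGaloisRestrict, ← torsionPointsEquiv_symm_smul]
  congr 1
  exact Subtype.ext (hfix g)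

/-- **EXACTNESS of the depth.** For `f` a `Γ_K`-equivariant operator of `E(K̄)` with `f² + f + 1 = 0`: if NOT every
point of `E[2^{j+1}](K̄)` is `Γ_E`-fixed, then every `Γ_E`-fixed point `R ∈ E(K̄_E)` killed by a power of `2` is killed
by `2^j` — the `Γ_E`-fixed part of `E[2^{N'}]` is an `f`-stable subgroup, hence the sub-line `E[2^{N'}][2^i]`
(uniseriality of the `ℤ[f]/2^{N'}`-line, `exists_mem_iff_two_pow_zsmul_eq_zero_of_fn_stable`), and `i ≤ j`.
[cite: Rubin1999, Cor. 5.5] [cite: SilvermanAEC2009, Cor. III.6.4(b)] -/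
theorem two_pow_zsmul_eq_zero_of_fixed_of_not_forall (f : W.geomPoints →+ W.geomPoints)
    (hfK : ∀ (σ : absoluteGaloisGroup K) (P : W.geomPoints), f (σ • P) = σ • f P)
    (hf : ∀ P, f (f P) + f P + P = 0) {j : ℕ}
    (hnot : ¬ ∀ (g : absoluteGaloisGroup E) (Q : geomTorsion W ((2 ^ (j + 1) : ℕ) : ℤ)),
      absGaloisRestrict K E g • Q = Q)
    {R : localPoints W E} {N' : ℕ} (hR : ((2 ^ N' : ℕ) : ℤ) • R = 0)
    (hRfix : ∀ σ : absoluteGaloisGroup E, σ • R = R) : ((2 ^ j : ℕ) : ℤ) • R = 0 := by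
  rcases le_or_gt N' j with hle | hlt
  · rw [show ((2 ^ j : ℕ) : ℤ) = ((2 ^ (j - N') : ℕ) : ℤ) * ((2 ^ N' : ℕ) : ℤ) by
      push_cast; rw [← pow_add, Nat.sub_add_cancel hle], mul_smul, hR, smul_zero]
  have hn : ((2 ^ N' : ℕ) : ℤ) ≠ 0 := by exact_mod_cast pow_ne_zero N' two_ne_zero
  -- the operator at level `2^N'`
  let fn : geomTorsion W ((2 ^ N' : ℕ) : ℤ) →+ geomTorsion W ((2 ^ N' : ℕ) : ℤ) :=
    (f.comp (geomTorsion W ((2 ^ N' : ℕ) : ℤ)).subtype).codRestrict _ fun Q ↦ by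
      rw [mem_geomTorsion_iff, AddMonoidHom.coe_comp, AddSubgroup.coe_subtype, Function.comp_apply, ← map_zsmul,
        (mem_geomTorsion_iff W _ _).mp Q.2, map_zero]
  have hrel : ∀ Q, fn (fn Q) + fn Q + Q = 0 := fun Q ↦ Subtype.ext (hf Q)
  -- the `Γ_E`-fixed sub-line
  let H : AddSubgroup (geomTorsion W ((2 ^ N' : ℕ) : ℤ)) :=
    { carrier := {Q | ∀ g : absoluteGaloisGroup E, absGaloisRestrict K E g • Q = Q}
      add_mem' := fun ha hb g ↦ by rw [smul_add, ha g, hb g]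
      zero_mem' := fun g ↦ smul_zero _
      neg_mem' := fun ha g ↦ by rw [smul_neg, ha g] }
  have hmemH : ∀ Q, Q ∈ H ↔ ∀ g : absoluteGaloisGroup E, absGaloisRestrict K E g • Q = Q := fun Q ↦ Iff.rfl
  have hH : ∀ Q ∈ H, fn Q ∈ H := fun Q hQ g ↦ by
    apply Subtype.ext
    change ((absGaloisRestrict K E g • fn Q : geomTorsion W _) : W.geomPoints) = f Q
    rw [AddSubgroup.torsionBy.coe_smul, show ((fn Q : geomTorsion W _) : W.geomPoints) = f Q from rfl, ← hfK,
      ← AddSubgroup.torsionBy.coe_smul, (hmemH Q).mp hQ g]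
  obtain ⟨i, -, hi⟩ := exists_mem_iff_two_pow_zsmul_eq_zero_of_fn_stable W (2 ^ N') fn rfl hrel H hH
  -- `R` comes from a point `Q_R ∈ H`
  have hR' : R ∈ AddSubgroup.torsionBy (localPoints W E) ((2 ^ N' : ℕ) : ℤ) := (Submodule.mem_torsionBy_iff _ _).mpr hR
  set QR := (W.torsionPointsEquiv ((2 ^ N' : ℕ) : ℤ) (E := E) hn).symm ⟨R, hR'⟩ with hQR
  have hQRH : QR ∈ H := fun g ↦ smul_torsionPointsEquiv_symm_eq_of_forall_smul_eq W E hn hR' hRfix g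
  have hQRi : ((2 : ℤ) ^ i) • QR = 0 := (hi QR).mp hQRH
  rcases le_or_gt i j with hij | hji
  · -- `2^j Q_R = 0`, read on points
    have h0 : ((2 : ℤ) ^ j) • QR = 0 := by
      rw [show j = (j - i) + i by omega, pow_add, mul_smul, hQRi, smul_zero]
    have h1 := congrArg (fun Q : geomTorsion W ((2 ^ N' : ℕ) : ℤ) ↦ pointsMap W E (Q : W.geomPoints)) h0
    simp only [AddSubgroupClass.coe_zsmul, map_zsmul, ZeroMemClass.coe_zero, map_zero] at h1
    rw [hQR, pointsMap_torsionPointsEquiv_symm] at h1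
    rw [Nat.cast_pow, Nat.cast_ofNat]
    exact h1
  · -- `i ≥ j + 1`: all of `E[2^{j+1}]` lies in `H`, contradiction
    refine (hnot fun g Q ↦ ?_).elim
    have hQ' : (Q : W.geomPoints) ∈ geomTorsion W ((2 ^ N' : ℕ) : ℤ) := by
      rw [mem_geomTorsion_iff, show ((2 ^ N' : ℕ) : ℤ) = ((2 ^ (N' - (j + 1)) : ℕ) : ℤ) * ((2 ^ (j + 1) : ℕ) : ℤ) by
        push_cast; rw [← pow_add, Nat.sub_add_cancel (by omega)], mul_smul, (mem_geomTorsion_iff W _ _).mp Q.2, smul_zero]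
    have hmem : (⟨(Q : W.geomPoints), hQ'⟩ : geomTorsion W ((2 ^ N' : ℕ) : ℤ)) ∈ H := by
      rw [hi, show i = (i - (j + 1)) + (j + 1) by omega, pow_add, mul_smul]
      have h2 : ((2 : ℤ) ^ (j + 1)) • (⟨(Q : W.geomPoints), hQ'⟩ : geomTorsion W ((2 ^ N' : ℕ) : ℤ)) = 0 := by
        have h3 := congrArg Subtype.val (two_pow_zsmul_geomTorsion W (2 ^ (j + 1)) rfl Q)
        rw [AddSubgroupClass.coe_zsmul, ZeroMemClass.coe_zero] at h3
        apply Subtype.ext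
        rw [AddSubgroupClass.coe_zsmul, ZeroMemClass.coe_zero]
        exact h3
      rw [h2, smul_zero]
    have h4 := congrArg Subtype.val (hmem g)
    rw [AddSubgroup.torsionBy.coe_smul] at h4
    apply Subtype.ext
    rw [AddSubgroup.torsionBy.coe_smul]
    exact h4

/-- **The parametrisation at a given exact depth `j`** (`E[2^j]` rational over the `K`-field `E`, `E[2^{j+1}]` not,
`M ≤ j`): an additive `κ : E[2^M] →+ H¹(Γ_E, E[2^M])`, `κ Z = κ_E(Q)` for ANY `Q ∈ E(K̄_E)` with `2^j Q = Z` (tree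
`localKummerClass`), INTO `𝓛_E`, INJECTIVE, and `𝒪`-LINEAR (`κ (fn Z) = H¹(F|Γ_E) (κ Z)`: `f_E Q` is a root of `fn Z`,
Kummer naturality). [cite: SilvermanAEC2009, VIII.§2] [cite: SerreGaloisCohomology1997, I.§2.4] [cite: Rubin1999, Cor. 5.5] -/
theorem exists_kummerLocal_line_parametrisation_of_depth (n : ℕ) [NeZero n] {M j : ℕ} (hn : n = 2 ^ M)
    (hMj : M ≤ j) (f : W.geomPoints →+ W.geomPoints)
    (hfK : ∀ (σ : absoluteGaloisGroup K) (P : W.geomPoints), f (σ • P) = σ • f P)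
    (hf : ∀ P, f (f P) + f P + P = 0)
    (fE : localPoints W E →+ localPoints W E)
    (hfE : ∀ (τ : absoluteGaloisGroup E) (P : localPoints W E), fE (τ • P) = τ • fE P)
    (hcomp : ∀ P : W.geomPoints, fE (pointsMap W E P) = pointsMap W E (f P))
    (fn : geomTorsion W (n : ℤ) →+ geomTorsion W (n : ℤ))
    (hfn : ∀ Q : geomTorsion W (n : ℤ), ((fn Q : geomTorsion W (n : ℤ)) : W.geomPoints) = f Q)
    (F : (W.torsionGaloisModule (n : ℤ)).toContRepresentation →ⁱL (W.torsionGaloisModule (n : ℤ)).toContRepresentation)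
    (hF : ∀ Q : geomTorsion W (n : ℤ), F Q = fn Q)
    (hrat : ∀ (g : absoluteGaloisGroup E) (Q : geomTorsion W ((2 ^ j : ℕ) : ℤ)), absGaloisRestrict K E g • Q = Q)
    (hnot : ¬ ∀ (g : absoluteGaloisGroup E) (Q : geomTorsion W ((2 ^ (j + 1) : ℕ) : ℤ)),
      absGaloisRestrict K E g • Q = Q) :
    ∃ κ : geomTorsion W (n : ℤ) →+ galoisCohomology (GaloisRep.restrictField E (W.torsionGaloisModule (n : ℤ))) 1,
      (∀ Z, κ Z ∈ W.kummerLocalConditionAt (n : ℤ) E) ∧ Function.Injective κ ∧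
      (∀ Z, κ (fn Z) = galoisCohomology.map (F.restrictField E) 1 (κ Z)) := by
  have hn0 : (n : ℤ) ≠ 0 := by exact_mod_cast NeZero.ne n
  have h2j : ((2 ^ j : ℕ) : ℤ) ≠ 0 := by exact_mod_cast pow_ne_zero j two_ne_zero
  -- roots of order `2^j` exist in `E(K̄_E)` (divisibility)
  have hdiv : ∀ P : localPoints W E, ∃ Q : localPoints W E, ((2 ^ j : ℕ) : ℤ) • Q = P := fun P ↦ by
    obtain ⟨Q₀, hQ₀⟩ := W.exists_zsmul_eq_geomPoints_baseChange E h2j ((W.baseChangeGeomPointsEquiv E).symm P)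
    exact ⟨W.baseChangeGeomPointsEquiv E Q₀, by rw [← map_zsmul, hQ₀, AddEquiv.apply_symm_apply]⟩
  -- `n • Q ∈ E(E)` whenever `2^j • Q = Z ∈ E[n]` (it is a `2^j`-torsion point, rational by `hrat`)
  have hfixQ : ∀ (Z : geomTorsion W (n : ℤ)) (Q : localPoints W E), ((2 ^ j : ℕ) : ℤ) • Q = pointsMap W E Z →
      (n : ℤ) • Q ∈ MulAction.fixedPoints (absoluteGaloisGroup E) (localPoints W E) := fun Z Q hQ σ ↦ by
    apply smul_eq_self_of_forall_smul_geomTorsion_eq W E hrat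
    rw [smul_comm, hQ, ← map_zsmul, (mem_geomTorsion_iff W (n : ℤ) _).mp Z.2, map_zero]
  choose root hroot using fun Z : geomTorsion W (n : ℤ) ↦ hdiv (pointsMap W E Z)
  -- independence of the root: `κ_E(root Z) = κ_E(Q)` for every root `Q` of `Z`
  have hκQ : ∀ (Z : geomTorsion W (n : ℤ)) (Q : localPoints W E) (hQ : ((2 ^ j : ℕ) : ℤ) • Q = pointsMap W E Z),
      W.localKummerClass (n : ℤ) hn0 (root Z) (hfixQ Z (root Z) (hroot Z)) =
        W.localKummerClass (n : ℤ) hn0 Q (hfixQ Z Q hQ) := fun Z Q hQ ↦ by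
    have hT : ((2 ^ j : ℕ) : ℤ) • (root Z - Q) = 0 := by rw [smul_sub, hroot, hQ, sub_self]
    have hDfix : ∀ σ : absoluteGaloisGroup E, σ • (root Z - Q) = root Z - Q :=
      fun σ ↦ smul_eq_self_of_forall_smul_geomTorsion_eq W E hrat hT σ
    have hTfix : (n : ℤ) • (root Z - Q) ∈ MulAction.fixedPoints (absoluteGaloisGroup E) (localPoints W E) :=
      fun σ ↦ by rw [smul_zsmul_localPoints, hDfix σ]
    have h0 : W.localKummerClass (n : ℤ) hn0 (root Z - Q) hTfix = 0 :=
      (W.localKummerClass_eq_zero_iff (n : ℤ) hn0 _ hTfix).mpr ⟨0, zero_mem _, by rw [sub_zero]; exact hDfix⟩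
    have hsum : (n : ℤ) • (Q + (root Z - Q)) ∈ MulAction.fixedPoints (absoluteGaloisGroup E) (localPoints W E) := by
      rw [add_sub_cancel]; exact hfixQ Z (root Z) (hroot Z)
    rw [localKummerClass_congr (hQ := hfixQ Z (root Z) (hroot Z)) (hQ' := hsum) (add_sub_cancel Q (root Z)).symm,
      W.localKummerClass_add (n : ℤ) hn0 Q (root Z - Q) (hfixQ Z Q hQ) hTfix hsum, h0, add_zero]
  -- additivity
  have hadd : ∀ Z₁ Z₂ : geomTorsion W (n : ℤ),
      W.localKummerClass (n : ℤ) hn0 (root (Z₁ + Z₂)) (hfixQ _ _ (hroot (Z₁ + Z₂))) =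
        W.localKummerClass (n : ℤ) hn0 (root Z₁) (hfixQ _ _ (hroot Z₁)) +
          W.localKummerClass (n : ℤ) hn0 (root Z₂) (hfixQ _ _ (hroot Z₂)) := fun Z₁ Z₂ ↦ by
    have h12 : ((2 ^ j : ℕ) : ℤ) • (root Z₁ + root Z₂) = pointsMap W E ↑(Z₁ + Z₂) := by
      rw [smul_add, hroot, hroot, AddSubgroup.coe_add, map_add]
    rw [hκQ (Z₁ + Z₂) _ h12]
    exact W.localKummerClass_add (n : ℤ) hn0 _ _ _ _ _
  refine ⟨AddMonoidHom.mk' _ hadd, fun Z ↦ W.localKummerClass_mem_kummerLocalConditionAt (n : ℤ) hn0 _ _, ?_,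
    fun Z ↦ ?_⟩
  · -- INJECTIVE: `κ Z = 0` ⇒ `root Z - T ∈ E(E)` for a `T ∈ E[n]`; it is `2`-power torsion, so killed by `2^j`
    -- (exactness of the depth), whence `Z = 2^j • root Z = 2^j • T = 0`
    rw [injective_iff_map_eq_zero]
    intro Z hZ
    obtain ⟨T, hT, hfixRT⟩ := (W.localKummerClass_eq_zero_iff (n : ℤ) hn0 _ _).mp hZ
    have hTn : (n : ℤ) • T = 0 := (Submodule.mem_torsionBy_iff _ _).mp hT
    have hA : (((2 ^ j : ℕ) : ℤ) * (n : ℤ)) • root Z = 0 := by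
      rw [mul_comm, mul_smul, hroot, ← map_zsmul, (mem_geomTorsion_iff W (n : ℤ) _).mp Z.2, map_zero]
    have hB : (((2 ^ j : ℕ) : ℤ) * (n : ℤ)) • T = 0 := by rw [mul_smul, hTn, smul_zero]
    have hR : ((2 ^ (j + M) : ℕ) : ℤ) • (root Z - T) = 0 := by
      rw [show ((2 ^ (j + M) : ℕ) : ℤ) = ((2 ^ j : ℕ) : ℤ) * (n : ℤ) by rw [hn]; push_cast; ring, smul_sub, hA, hB,
        sub_zero]
    have hj := two_pow_zsmul_eq_zero_of_fixed_of_not_forall W E f hfK hf hnot hR (fun σ ↦ hfixRT σ)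
    have hjT : ((2 ^ j : ℕ) : ℤ) • T = 0 := by
      rw [show ((2 ^ j : ℕ) : ℤ) = ((2 ^ (j - M) : ℕ) : ℤ) * (n : ℤ) by
        rw [hn]; push_cast; rw [← pow_add, Nat.sub_add_cancel hMj], mul_smul, hTn, smul_zero]
    have hZ0 : pointsMap W E (Z : W.geomPoints) = pointsMap W E 0 := by
      rw [← hroot, ← sub_add_cancel (root Z) T, smul_add, hj, hjT, zero_add, map_zero]
    exact Subtype.ext (pointsMapOfEmb_injective W _ hZ0)
  · -- `𝒪`-LINEAR: `f_E (root Z)` is a root of `fn Z`, and its Kummer cocycle is `F ∘` (that of `root Z`)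
    have hQ' : ((2 ^ j : ℕ) : ℤ) • fE (root Z) = pointsMap W E ↑(fn Z) := by
      rw [← map_zsmul, hroot, hcomp, hfn]
    have hinj : Function.Injective fun P : geomTorsion W (n : ℤ) ↦ pointsMap W E (P : W.geomPoints) :=
      fun P Q h ↦ Subtype.ext (pointsMapOfEmb_injective W _ h)
    change W.localKummerClass (n : ℤ) hn0 (root (fn Z)) _ =
      galoisCohomology.map (F.restrictField E) 1 (W.localKummerClass (n : ℤ) hn0 (root Z) _)
    rw [hκQ (fn Z) (fE (root Z)) hQ']
    unfold WeierstrassCurve.localKummerClass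
    rw [galoisCohomology.map_one_oneCocycleClass]
    refine congrArg (oneCocycleClass _) (Subtype.ext (ContinuousMap.ext fun σ ↦ hinj ?_))
    change pointsMap W E ((W.localKummerCocycle (n : ℤ) hn0 (fE (root Z)) (hfixQ _ _ hQ')).1 σ : W.geomPoints) =
      pointsMap W E ((F ((W.localKummerCocycle (n : ℤ) hn0 (root Z) (hfixQ _ _ (hroot Z))).1 σ) :
        geomTorsion W (n : ℤ)) : W.geomPoints)
    rw [pointsMap_localKummerCocycle_apply, hF, hfn, ← hcomp, pointsMap_localKummerCocycle_apply, map_sub, hfE]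

end Generic

/-! ## At a finite place: the depth is bounded, and the parametrisation -/

section AdicCompletion

open NumberField IsDedekindDomain

variable {K : Type u} [Field K] [NumberField K] (W : WeierstrassCurve K) [W.IsElliptic]
variable (v : HeightOneSpectrum (𝓞 K))

/-- **Some `E[2^N]` is not `K_v`-rational**: `E(K_v)` has a torsion-free subgroup `U` of finite index (Silverman
VII.6.3), `E(K_v)[2^N] ↪ E(K_v)/U`, while `#E(K_v)[2^N] = 4^N` if `Γ_{K_v}` fixes `E[2^N]`.
[cite: SilvermanAEC2009, Prop. VII.6.3] [cite: McCallumLMS1991, §4 (p. 300)] -/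
theorem exists_not_forall_smul_geomTorsion_eq_adicCompletion :
    ∃ B : ℕ, ∀ N, B ≤ N → ¬ ∀ (g : absoluteGaloisGroup (v.adicCompletion K)) (Q : geomTorsion W ((2 ^ N : ℕ) : ℤ)),
      absGaloisRestrict K (v.adicCompletion K) g • Q = Q := by
  obtain ⟨U, hU, htf, -⟩ := W.exists_finiteIndex_torsionFree_adicCompletion v
  haveI := hU
  haveI : Finite ((W.baseChange (v.adicCompletion K)).toAffine.Point ⧸ U) := AddSubgroup.finite_quotient_of_finiteIndex
  refine ⟨U.index, fun N hN hrat ↦ ?_⟩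
  -- `E(K_v)[2^N] ↪ E(K_v)/U`
  have hinj : Function.Injective fun x : (nsmulAddMonoidHom (2 ^ N) :
      (W.baseChange (v.adicCompletion K)).toAffine.Point →+ _).ker ↦
        ((x : (W.baseChange (v.adicCompletion K)).toAffine.Point) : _ ⧸ U) := by
    rintro ⟨x, hx⟩ ⟨y, hy⟩ hxy
    apply Subtype.ext
    have hmem : -x + y ∈ U := QuotientAddGroup.eq.mp hxy
    rw [AddMonoidHom.mem_ker, nsmulAddMonoidHom_apply] at hx hy
    have h0 : (2 ^ N) • (-x + y) = 0 := by rw [nsmul_add, neg_nsmul, hx, hy, neg_zero, add_zero]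
    have h := htf (2 ^ N) (pow_ne_zero N two_ne_zero) _ hmem h0
    rwa [neg_add_eq_zero] at h
  have hle := Nat.card_le_card_of_injective _ hinj
  rw [W.natCard_ker_nsmul_adicCompletion_eq_sq_of_forall_smul_eq v (pow_ne_zero N two_ne_zero)
    (closureEmb (K := K) (v.adicCompletion K)) (fun σ P ↦ by
      rw [← resGal_eq, resGal_eq_absGaloisRestrict]; exact hrat σ P)] at hle
  have h1 : (2 ^ N) ^ 2 ≤ U.index := hle
  have h2 : N < 2 ^ N := Nat.lt_two_pow_self
  nlinarith [Nat.one_le_two_pow (n := N)]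

/-- ★ **The local Kummer parametrisation by the `ℤ[f]/2^M`-line `E[2^M]`.** `E = W/K` elliptic over a number field,
`f` a `Γ_K`-equivariant operator of `E(K̄)` with `f² + f + 1 = 0` admitting a local points map `f_v` at `K_v`
(`v ∤ 2`; every `K`-isogeny does, `Isogeny.hasLocalPointsMaps_toAddMonoidHom`), `F` the intertwining map of `E[n]`
over `f` (`fn` its map on points), `n = 2^M`, and `Γ_{K_v}` fixing `E[n](K̄)`.  Then there is an additive
`κ : E[n] →+ H¹(Γ_{K_v}, E[n])` which is INTO and ONTO the local Kummer condition `𝓛_v = im (E(K_v)/n ↪ H¹(K_v, E[n]))`,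
INJECTIVE, and `𝒪`-LINEAR: `κ (fn Z) = H¹(F|Γ_{K_v}) (κ Z)` — i.e. `E(K_v)/2^M ≅ E[2^M]` as a `ℤ[f]/2^M`-module (free
of rank one), the `p = 2` CM form of McCallum's «`E(K_λ)/p^M ≅ E_{p^M}`, `±`-parts cyclic».  These are the binders
`κ, hκ, hκs, fn` of `inv_weilLocalCup_ne_zero_or_of_line` / `ctLocalTerm_ne_zero_or_of_line` (with `n := m * m`).
[cite: McCallumLMS1991, §4 Prop. 4.4 and §5 Lemma 5.3] [cite: Rubin1999, Cor. 5.5] [cite: SerreGaloisCohomology1997, I.§2.4] -/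
theorem exists_kummerLocal_line_parametrisation (h2v : ((2 : ℕ) : 𝓞 K) ∉ v.asIdeal)
    (n : ℕ) [NeZero n] {M : ℕ} (hn : n = 2 ^ M)
    (f : W.geomPoints →+ W.geomPoints)
    (hfK : ∀ (σ : absoluteGaloisGroup K) (P : W.geomPoints), f (σ • P) = σ • f P)
    (hf : ∀ P, f (f P) + f P + P = 0)
    (fE : localPoints W (v.adicCompletion K) →+ localPoints W (v.adicCompletion K))
    (hfE : ∀ (τ : absoluteGaloisGroup (v.adicCompletion K)) (P : localPoints W (v.adicCompletion K)),
      fE (τ • P) = τ • fE P)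
    (hcomp : ∀ P : W.geomPoints, fE (pointsMap W (v.adicCompletion K) P) = pointsMap W (v.adicCompletion K) (f P))
    (fn : geomTorsion W (n : ℤ) →+ geomTorsion W (n : ℤ))
    (hfn : ∀ Q : geomTorsion W (n : ℤ), ((fn Q : geomTorsion W (n : ℤ)) : W.geomPoints) = f Q)
    (F : (W.torsionGaloisModule (n : ℤ)).toContRepresentation →ⁱL (W.torsionGaloisModule (n : ℤ)).toContRepresentation)
    (hF : ∀ Q : geomTorsion W (n : ℤ), F Q = fn Q)
    (hfix : ∀ (g : absoluteGaloisGroup (v.adicCompletion K)) (Q : geomTorsion W (n : ℤ)),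
      absGaloisRestrict K (v.adicCompletion K) g • Q = Q) :
    ∃ κ : geomTorsion W (n : ℤ) →+
        galoisCohomology (GaloisRep.restrictField (v.adicCompletion K) (W.torsionGaloisModule (n : ℤ))) 1,
      (∀ Z, κ Z ∈ W.kummerLocalConditionAt (n : ℤ) (v.adicCompletion K)) ∧
      (∀ y ∈ W.kummerLocalConditionAt (n : ℤ) (v.adicCompletion K), ∃ Z, κ Z = y) ∧
      Function.Injective κ ∧
      (∀ Z, κ (fn Z) = galoisCohomology.map (F.restrictField (v.adicCompletion K)) 1 (κ Z)) := by
  subst hn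
  -- the exact depth `j = M + k`: `E[2^j]` rational over `K_v`, `E[2^{j+1}]` not
  obtain ⟨B, hB⟩ := exists_not_forall_smul_geomTorsion_eq_adicCompletion W v
  have hex : ∃ k, ¬ ∀ (g : absoluteGaloisGroup (v.adicCompletion K))
      (Q : geomTorsion W ((2 ^ (M + k + 1) : ℕ) : ℤ)), absGaloisRestrict K (v.adicCompletion K) g • Q = Q :=
    ⟨B, hB _ (by omega)⟩
  have hrat : ∀ (g : absoluteGaloisGroup (v.adicCompletion K)) (Q : geomTorsion W ((2 ^ (M + Nat.find hex) : ℕ) : ℤ)),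
      absGaloisRestrict K (v.adicCompletion K) g • Q = Q := by
    rcases Nat.eq_zero_or_pos (Nat.find hex) with h0 | hpos
    · rw [h0, add_zero]; exact hfix
    · have h := Nat.find_min hex (m := Nat.find hex - 1) (by omega)
      rw [show M + Nat.find hex = M + (Nat.find hex - 1) + 1 by omega]
      exact not_not.mp h
  obtain ⟨κ, hκ, hinj, hlin⟩ := exists_kummerLocal_line_parametrisation_of_depth W (v.adicCompletion K) (2 ^ M) rfl
    (Nat.le_add_right M (Nat.find hex)) f hfK hf fE hfE hcomp fn hfn F hF hrat (Nat.find_spec hex)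
  refine ⟨κ, hκ, fun y hy ↦ ?_, hinj, hlin⟩
  -- ONTO by counting: `#𝓛_v = #E(K_v)[n] · #(𝓞_v/n) = n² · 1 = #E[n]`, and `κ` is injective
  have hM0 : (2 ^ M : ℕ) ≠ 0 := pow_ne_zero M two_ne_zero
  haveI : Finite (W.kummerLocalConditionAt ((2 ^ M : ℕ) : ℤ) (v.adicCompletion K)) :=
    W.finite_kummerLocalConditionAt_adicCompletion v hM0
  have hnv : ((2 ^ M : ℕ) : 𝓞 K) ∉ v.asIdeal := fun h ↦
    h2v (v.isPrime.mem_of_pow_mem M (by rwa [Nat.cast_pow] at h))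
  have hcardL : Nat.card (W.kummerLocalConditionAt ((2 ^ M : ℕ) : ℤ) (v.adicCompletion K)) = (2 ^ M) ^ 2 := by
    rw [W.natCard_kummerLocalConditionAt_adicCompletion v hM0,
      natCard_adicCompletionIntegers_quotient_span_natCast_eq_one v hnv, mul_one,
      W.natCard_ker_nsmul_adicCompletion_eq_sq_of_forall_smul_eq v hM0 (closureEmb (K := K) (v.adicCompletion K))
        (fun σ P ↦ by rw [← resGal_eq, resGal_eq_absGaloisRestrict]; exact hfix σ P)]
  have hcardT : Nat.card (geomTorsion W ((2 ^ M : ℕ) : ℤ)) = (2 ^ M) ^ 2 := by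
    rw [W.natCard_geomTorsion _ (by exact_mod_cast hM0), Int.natAbs_natCast]
  have hκ'inj : Function.Injective fun Z : geomTorsion W ((2 ^ M : ℕ) : ℤ) ↦
      (⟨κ Z, hκ Z⟩ : W.kummerLocalConditionAt ((2 ^ M : ℕ) : ℤ) (v.adicCompletion K)) :=
    fun Z₁ Z₂ h ↦ hinj (congrArg Subtype.val h)
  obtain ⟨Z, hZ⟩ := (hκ'inj.bijective_of_nat_card_le (by rw [hcardL, hcardT])).2 ⟨y, hy⟩
  exact ⟨Z, congrArg Subtype.val hZ⟩

end AdicCompletion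

end Literature.NumberTheory.EllipticCurves.JZero

/-! ## Order bookkeeping at the level `m²`: `ι_* [m]_* = m` -/

namespace Literature.NumberTheory.EllipticCurves

open _root_.WeierstrassCurve Field Literature.NumberTheory.GaloisRepresentations
open scoped ContRepresentation

/-- **ORDER BOOKKEEPING for the second local order** (McCallum Prop. 4.4 coupling, the `hyb` of #40): over a `K`-field
`E`, if `β' ∈ H¹(Γ_E, E[m²])` lifts `res_E b'` along `[m]` (`FirstCaseData.map_β'`), `ι_* b' = t`, and
`res_E (c • t) ≠ 0` (i.e. `c • t ∉ ker loc_E`, tree `mem_torsionLocalKer_iff_res_eq_zero`), then `(c * m) • β' ≠ 0` —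
because `m • β' = ι_* [m]_* β' = ι_* res_E b' = res_E t`. [cite: McCallumLMS1991, §4 Prop. 4.4 and §5 (proof of Thm. 5.4)]
[cite: MilneADT2006, Ch. I §6, proof of Prop. 6.9] -/
theorem mul_zsmul_ne_zero_of_map_mulK_eq_res {K : Type u} [Field K] (W : WeierstrassCurve K) (m : ℕ)
    (E : Type u) [Field E] [Algebra K E]
    {β' : galoisCohomology (GaloisRep.restrictField E (W.torsionGaloisModule ((m * m : ℕ) : ℤ))) 1}
    {b' : galoisCohomology (W.torsionGaloisModule (m : ℤ)) 1}
    {t : galoisCohomology (W.torsionGaloisModule ((m * m : ℕ) : ℤ)) 1} {c : ℤ}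
    (hβ' : galoisCohomology.map ((mulK W m m).restrictField E) 1 β' =
      galoisCohomology.res (W.torsionGaloisModule (m : ℤ)) E 1 b')
    (hb' : galoisCohomology.map (inclKD W m m) 1 b' = t)
    (ht : galoisCohomology.res (W.torsionGaloisModule ((m * m : ℕ) : ℤ)) E 1 (c • t) ≠ 0) :
    (c * (m : ℤ)) • β' ≠ 0 := by
  intro h
  apply ht
  rw [map_zsmul, ← hb', galoisCohomology.res_map_one, ← hβ', map_inclKD_map_mulK_restrictField, smul_smul, h]

end Literature.NumberTheory.EllipticCurves

end
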